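import Summits.CriticalPhenomena.SAWScalingLimit.Theorems.IsingBoundaryRatio.Negative.IsingBoundaryRatioLattice

/-!
# Negative-side results for the crux `SAWLoopFugacityFlow.IsingBoundaryRatio` (stmt-CriticalPhenomena-10650):
EVENTUAL NESTING of the mesh domains `meshDomain D' δ ⊆ meshDomain D δ` under the crux hypotheses
(the tie convention of `meshDomain` is inert), identification of the crux ratio with the route's
loop-model object `R_δ(1; D, D')` at the Ising point, and the consequences of positivity + GKS:
the ratio is eventually in `(0,1]`, every limit is `≤ 1`, negative-exponent variants are false
(work-file §3, §6).

Refuter `cdisprove` (standing adversary); the full indexed work file is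
`Summits/CriticalPhenomena/SAWScalingLimit/Cruxes/IsingBoundaryRatio/Disproof.lean`.
-/

noncomputable section

open scoped Classical symmDiff
open MeasureTheory Filter Topology Set Function Metric
open Literature.Probability.LatticeModels Literature.Probability.RandomPlanarGeometry
open UpperHalfPlane (upperHalfPlaneSet)

namespace Summit.CriticalPhenomena.SAWScalingLimit.Theorems.IsingBoundaryRatio.Negative

open Summit.CriticalPhenomena.SAWScalingLimit.Theses.SAWLoopFugacityFlow (IsingBoundaryRatio)

/-- Auxiliary lattice/real-analysis fact for the negative-side analysis of `IsingBoundaryRatio` (see the module docstring). [folklore] -/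
theorem meshGraph_mono {Ω' Ω : Set ℂ} (h : Ω' ⊆ Ω) (δ : ℝ) : meshGraph Ω' δ ≤ meshGraph Ω δ := by
  intro x y hxy
  rw [meshGraph_adj_iff] at hxy ⊢
  exact ⟨hxy.1, hxy.2.trans (closure_mono h)⟩

/-- Auxiliary lattice/real-analysis fact for the negative-side analysis of `IsingBoundaryRatio` (see the module docstring). [folklore] -/
theorem meshVertices_mono {Ω' Ω : Set ℂ} (h : Ω' ⊆ Ω) (δ : ℝ) : meshVertices Ω' δ ⊆ meshVertices Ω δ :=
  fun _ hx => h hx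

/-- GRAPH INCLUSION: if `Ω' ⊆ Ω` and `meshDomain Ω' δ ⊆ meshDomain Ω δ` then `Ω'_δ ≤ Ω_δ`. [folklore] -/
theorem discreteDomainGraph_mono {Ω' Ω : Set ℂ} {δ : ℝ} (hsub : Ω' ⊆ Ω)
    (hΛ : meshDomain Ω' δ ⊆ meshDomain Ω δ) : discreteDomainGraph Ω' δ ≤ discreteDomainGraph Ω δ := by
  intro x y hxy
  rw [discreteDomainGraph_adj_iff] at hxy ⊢
  obtain ⟨hadj, hx, hy⟩ := hxy
  exact ⟨meshGraph_mono hsub δ hadj, hΛ hx, hΛ hy⟩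

/-- GKS SANDWICH (Griffiths II, proved in the tree): for `δ > 0`, `Ω' ⊆ Ω` bounded with nested mesh
domains and `x, y ∈ Ω'_δ`: `T Ω' δ x y ≤ T Ω δ x y` (fewer edges and a smaller free volume can only
decrease ferromagnetic correlations). [folklore] -/
theorem T_mono {Ω' Ω : Set ℂ} {δ : ℝ} (hΩ : Bornology.IsBounded Ω) (hδ : 0 < δ) (hsub : Ω' ⊆ Ω)
    (hΛ : meshDomain Ω' δ ⊆ meshDomain Ω δ) {x y : Site 2} (hx : x ∈ meshDomainFinset Ω' δ)
    (hy : y ∈ meshDomainFinset Ω' δ) : T Ω' δ x y ≤ T Ω δ x y := by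
  have hΩ' : Bornology.IsBounded Ω' := hΩ.subset hsub
  have hΛ' : meshDomainFinset Ω' δ ⊆ meshDomainFinset Ω δ := by
    intro v hv
    rw [← Finset.mem_coe, coe_meshDomainFinset hΩ hδ]
    rw [← Finset.mem_coe, coe_meshDomainFinset hΩ' hδ] at hv
    exact hΛ hv
  have hA : ({x} ∆ {y} : Finset (Site 2)) ⊆ meshDomainFinset Ω' δ :=
    symmDiff_le_sup.trans (sup_le (Finset.singleton_subset_iff.2 hx) (Finset.singleton_subset_iff.2 hy))
  unfold T
  rw [isingTwoPoint, spinPair_eq_spinProduct_symmDiff, ← isingCorr, isingTwoPoint,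
    spinPair_eq_spinProduct_symmDiff, ← isingCorr]
  calc isingCorr (discreteDomainGraph Ω' δ) (meshDomainFinset Ω' δ) criticalBetaTwo 0 .free ({x} ∆ {y})
      ≤ isingCorr (discreteDomainGraph Ω δ) (meshDomainFinset Ω' δ) criticalBetaTwo 0 .free ({x} ∆ {y}) :=
        isingCorr_free_mono_graph (fun Λ A B β h bc => GKSInequalities.gks_two_holds _)
          (discreteDomainGraph_mono hsub hΛ) criticalBetaTwo_pos.le le_rfl hA
    _ ≤ isingCorr (discreteDomainGraph Ω δ) (meshDomainFinset Ω δ) criticalBetaTwo 0 .free ({x} ∆ {y}) :=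
        isingCorr_free_mono_volume_of_gks _ (fun G' _ Λ A B β h bc => GKSInequalities.gks_two_holds G')
          criticalBetaTwo_pos.le le_rfl hA hΛ'

/-- The inclusion `Ω'_δ-vertices → Ω_δ-vertices` as a homomorphism of mesh vertex graphs. -/
def meshVertexHom {Ω' Ω : Set ℂ} (h : Ω' ⊆ Ω) (δ : ℝ) : meshVertexGraph Ω' δ →g meshVertexGraph Ω δ where
  toFun v := ⟨v.1, meshVertices_mono h δ v.2⟩
  map_rel' hadj := meshGraph_mono h δ hadj

/-- `meshDomain` is saturated under reachability in the mesh vertex graph (it is a union of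
supports of connected components; tree lemma `mem_meshDomain_of_adj`). [folklore] -/
theorem mem_meshDomain_of_reachable_vertex {Ω : Set ℂ} {δ : ℝ} {x y : meshVertices Ω δ}
    (hx : (x : Site 2) ∈ meshDomain Ω δ) (h : (meshVertexGraph Ω δ).Reachable x y) :
    (y : Site 2) ∈ meshDomain Ω δ := by
  obtain ⟨p⟩ := h
  induction p with
  | nil => exact hx
  | cons hadj _ ih => exact ih (mem_meshDomain_of_adj hx hadj)

/-- Eventually the two lattice endpoints are distinct (their mesh points converge to the distinct
marked points). [folklore] -/
theorem eventually_ne {D : DobrushinDomain} {a b : ℝ → Site 2} (h : SAW.IsEndpointApprox D a b) :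
    ∀ᶠ δ in 𝓝[>] (0 : ℝ), a δ ≠ b δ := by
  have h01 : D.pt 0 ≠ D.pt 1 := fun h => absurd (D.pt_injective h) (by decide)
  have hr : 0 < dist (D.pt 0) (D.pt 1) := dist_pos.2 h01
  filter_upwards [Metric.tendsto_nhds.1 h.tendsto_fst _ (half_pos hr),
    Metric.tendsto_nhds.1 h.tendsto_snd _ (half_pos hr)] with δ ha hb hab
  rw [hab] at ha
  have := dist_triangle_left (D.pt 0) (D.pt 1) (meshPoint δ (b δ))
  linarith

/-- THE DISCRETE DOMAINS ARE NESTED EVENTUALLY: under the crux hypotheses (both endpoint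
approximations, `D' ⊆ D`), `meshDomain D' δ ⊆ meshDomain D δ` for all small `δ > 0` — the largest
mesh component of the Jordan domain `D'` is eventually unique
(`JordanDomain.eventually_forall_mem_meshDomain'`), contains `a δ`, and `a δ ∈ Ω_δ`. So the tie
convention of `meshDomain` (union of all largest components) never bites. [folklore] -/
theorem eventually_meshDomain_subset {D D' : DobrushinDomain} {a b : ℝ → Site 2}
    (hD : SAW.IsEndpointApprox D a b) (hD' : SAW.IsEndpointApprox D' a b)
    (hsub : D'.carrier ⊆ D.carrier) :
    ∀ᶠ δ in 𝓝[>] (0 : ℝ), meshDomain D'.carrier δ ⊆ meshDomain D.carrier δ := by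
  filter_upwards [hD.reachable, hD'.reachable, eventually_ne hD,
    D'.toJordanDomain.eventually_forall_mem_meshDomain' isCompact_empty (empty_subset _)]
    with δ hr hr' hne hconn y hy
  have ha' : a δ ∈ meshDomain D'.carrier δ := mem_meshDomain_of_reachable_ne hr' hne
  have ha : a δ ∈ meshDomain D.carrier δ := mem_meshDomain_of_reachable_ne hr hne
  obtain ⟨hav, hyv, hreach⟩ := hconn.2 (a δ) ha' y hy
  have hreachD := hreach.map (meshVertexHom hsub δ)
  exact mem_meshDomain_of_reachable_vertex (x := ⟨a δ, meshVertices_mono hsub δ hav⟩) ha hreachD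

/-- THE OUTER ENDPOINT APPROXIMATION IS IDLE: if `(a_δ, b_δ)` is an endpoint approximation of the
SUBdomain `D' ⊆ D` (same marked points), it is one of `D`. The bulk component of `D'_δ` (eventually
the unique largest one, `JordanDomain.eventually_forall_mem_meshDomain'`) contains the lattice point
nearest to a fixed interior point `z₀ ∈ D'`, which lies in the bulk component of `D_δ` too; mesh
paths of `D'` are mesh paths of `D`, and `meshDomain` is saturated under them. (The converse
implication fails for comb-like `D'`: see the work file.) [folklore] -/
theorem isEndpointApprox_of_subdomain {D D' : DobrushinDomain} {a b : ℝ → Site 2}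
    (h' : SAW.IsEndpointApprox D' a b) (hsub : D'.carrier ⊆ D.carrier) (h0 : D'.pt 0 = D.pt 0)
    (h1 : D'.pt 1 = D.pt 1) : SAW.IsEndpointApprox D a b := by
  refine ⟨?_, h0 ▸ h'.tendsto_fst, h1 ▸ h'.tendsto_snd⟩
  -- a closed disc inside `D'`
  obtain ⟨z₀, hz₀⟩ := D'.nonempty
  obtain ⟨r, hr, hball⟩ := Metric.isOpen_iff.1 D'.isOpen z₀ hz₀
  have hK : IsCompact (closedBall z₀ (r / 2)) := isCompact_closedBall _ _
  have hKD' : closedBall z₀ (r / 2) ⊆ D'.carrier := (closedBall_subset_ball (by linarith)).trans hball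
  have hKD : closedBall z₀ (r / 2) ⊆ D.carrier := hKD'.trans hsub
  filter_upwards [h'.reachable, D'.toJordanDomain.eventually_forall_mem_meshDomain' hK hKD',
    D.toJordanDomain.eventually_forall_mem_meshDomain' hK hKD, Ioo_mem_nhdsGT (half_pos hr)]
    with δ hr' hD' hD hδ
  by_cases hne : a δ = b δ
  · rw [hne]
  set v : Site 2 := nearestSite δ z₀ with hv
  have hvK : meshPoint δ v ∈ closedBall z₀ (r / 2) :=
    mem_closedBall.2 ((dist_meshPoint_nearestSite_le hδ.1 z₀).trans hδ.2.le)
  have hvD' : v ∈ meshDomain D'.carrier δ := hD'.1 v hvK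
  have hvD : v ∈ meshDomain D.carrier δ := hD.1 v hvK
  -- `a δ`, `b δ` lie in the bulk of `D'_δ`
  have ha' : a δ ∈ meshDomain D'.carrier δ := mem_meshDomain_of_reachable_ne hr' hne
  have hb' : b δ ∈ meshDomain D'.carrier δ := mem_meshDomain_of_reachable_ne hr'.symm (Ne.symm hne)
  obtain ⟨hvv, hav, hva⟩ := hD'.2 v hvD' (a δ) ha'
  obtain ⟨hvv', hbv, hvb⟩ := hD'.2 v hvD' (b δ) hb'
  -- transport to the mesh vertex graph of `D`
  have hva' : (meshVertexGraph D.carrier δ).Reachable (meshVertexHom hsub δ ⟨v, hvv⟩)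
      (meshVertexHom hsub δ ⟨a δ, hav⟩) := hva.map (meshVertexHom hsub δ)
  have hvb' : (meshVertexGraph D.carrier δ).Reachable (meshVertexHom hsub δ ⟨v, hvv'⟩)
      (meshVertexHom hsub δ ⟨b δ, hbv⟩) := hvb.map (meshVertexHom hsub δ)
  have haD : a δ ∈ meshDomain D.carrier δ :=
    mem_meshDomain_of_reachable_vertex (x := ⟨v, meshVertices_mono hsub δ hvv⟩) hvD hva'
  obtain ⟨q⟩ := hva'.symm.trans hvb'
  exact reachable_discreteDomainGraph_of_walk q haD

/-- The crux with the OUTER endpoint approximation `SAW.IsEndpointApprox D a b` deleted. -/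
def WithoutOuterApprox : Prop :=
  ∀ (D D' : DobrushinDomain) (a b : ℝ → Site 2),
    SAW.IsEndpointApprox D' a b → D'.carrier ⊆ D.carrier → D'.pt 0 = D.pt 0 → D'.pt 1 = D.pt 1 →
    (∃ ε : ℝ, 0 < ε ∧ D'.carrier ∩ Metric.ball (D.pt 0) ε = D.carrier ∩ Metric.ball (D.pt 0) ε ∧
      D'.carrier ∩ Metric.ball (D.pt 1) ε = D.carrier ∩ Metric.ball (D.pt 1) ε) →
    ∀ (φ : ConformalEquiv upperHalfPlaneSet D.carrier), D.IsChordalUniformizing φ →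
    ∀ (A : Set ℂ), A = closure (upperHalfPlaneSet \ {z | z ∈ upperHalfPlaneSet ∧ φ z ∈ D'.carrier}) →
    ∀ (Φ : ConformalEquiv (upperHalfPlaneSet \ A) upperHalfPlaneSet) (d : ℝ),
    IsRestrictionMap A Φ → HasRestrictionDeriv A Φ d →
    Tendsto (ratio D D' a b) (𝓝[>] 0) (𝓝 (d ^ ((1 : ℝ) / 2)))

/-- The OUTER endpoint approximation is IDLE: deleting it gives an equivalent statement. (The
INNER one `SAW.IsEndpointApprox D' a b` is NOT idle: for comb-like hull subdomains `D'` whose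
corridors accumulate at `a`, endpoints `a_δ ∈ Ω_δ ∖ Ω'_δ` exist along `δ → 0`, where the inline
`⟨σ_{a_δ}σ_{b_δ}⟩_{Ω'_δ}` is the frozen-spin junk `⟨σ_{b_δ}⟩ = 0` and the ratio vanishes — prose,
work file.) [folklore] -/
theorem normalForm_iff_withoutOuterApprox : NormalForm ↔ WithoutOuterApprox := by
  constructor
  · intro h D D' a b hD' hsub h0 h1 hε φ hφ A hA Φ d hΦ hd
    exact h D D' a b (isEndpointApprox_of_subdomain hD' hsub h0 h1) hD' hsub h0 h1 hε φ hφ A hA Φ d hΦ hd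
  · intro h D D' a b _ hD' hsub h0 h1 hε φ hφ A hA Φ d hΦ hd
    exact h D D' a b hD' hsub h0 h1 hε φ hφ A hA Φ d hΦ hd

/-- Eventually the ratio IS the route's loop-model object at the Ising point,
`R_δ(1; D, D') = domainBoundaryRatio ⟨1, ½, tanh β_c⟩ D' D δ (a δ) (b δ)` (the `n = 1` case of the
informal crux IsingWindow), by the tree's high-temperature identity
`DiluteLoopModel.domainBoundaryRatio_isingPoint`. [folklore] -/
theorem eventually_ratio_eq_domainBoundaryRatio {D D' : DobrushinDomain} {a b : ℝ → Site 2}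
    (hD : SAW.IsEndpointApprox D a b) (hD' : SAW.IsEndpointApprox D' a b)
    (hsub : D'.carrier ⊆ D.carrier) :
    ∀ᶠ δ in 𝓝[>] (0 : ℝ), ratio D D' a b δ =
      (⟨1, 2⁻¹, Real.tanh criticalBetaTwo⟩ : DiluteLoopModel ℝ).domainBoundaryRatio
        D'.carrier D.carrier δ (a δ) (b δ) := by
  filter_upwards [hD.reachable, hD'.reachable, eventually_ne hD, self_mem_nhdsWithin]
    with δ hr hr' hne hδ
  obtain ⟨hx, hy⟩ := mem_meshDomainFinset_of_reachable_ne D.isBounded hδ hr hne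
  obtain ⟨hx', hy'⟩ := mem_meshDomainFinset_of_reachable_ne (D.isBounded.subset hsub) hδ hr' hne
  rw [DiluteLoopModel.domainBoundaryRatio_isingPoint hx' hy' hx hy]
  rfl

/-! ## §6 The diagonal `D' = D` is TRUE; the general position of the ratio -/

/-- Eventually along `𝓝[>] 0` the denominator of the crux is positive (no `0/0` junk). [folklore] -/
theorem eventually_T_pos {D : DobrushinDomain} {a b : ℝ → Site 2} (h : SAW.IsEndpointApprox D a b) :
    ∀ᶠ δ in 𝓝[>] (0 : ℝ), 0 < T D.carrier δ (a δ) (b δ) := by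
  filter_upwards [h.reachable, self_mem_nhdsWithin] with δ hr hδ
  exact T_pos_of_reachable D.isBounded hδ hr

/-- On the diagonal the ratio is eventually IDENTICALLY `1`. [folklore] -/
theorem eventually_ratio_self {D : DobrushinDomain} {a b : ℝ → Site 2} (h : SAW.IsEndpointApprox D a b) :
    ratio D D a b =ᶠ[𝓝[>] (0 : ℝ)] fun _ => 1 := by
  filter_upwards [eventually_T_pos h] with δ hδ
  exact div_self hδ.ne'

/-- GENERAL POSITION OF THE RATIO (unconditional): under the crux hypotheses the ratio lies in
`(0, 1]` for all small `δ > 0` (strict positivity + GKS sandwich + eventual nesting, §3). [folklore] -/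
theorem eventually_ratio_mem_Ioc {D D' : DobrushinDomain} {a b : ℝ → Site 2}
    (hD : SAW.IsEndpointApprox D a b) (hD' : SAW.IsEndpointApprox D' a b)
    (hsub : D'.carrier ⊆ D.carrier) :
    ∀ᶠ δ in 𝓝[>] (0 : ℝ), ratio D D' a b δ ∈ Ioc (0 : ℝ) 1 := by
  filter_upwards [hD.reachable, hD'.reachable, eventually_meshDomain_subset hD hD' hsub,
    eventually_ne hD, self_mem_nhdsWithin] with δ hr hr' hΛδ hneδ hδ
  obtain ⟨hx, hy⟩ := mem_meshDomainFinset_of_reachable_ne (D.isBounded.subset hsub) hδ hr' hneδ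
  refine ⟨div_pos (T_pos_of_reachable (D.isBounded.subset hsub) hδ hr')
    (T_pos_of_reachable D.isBounded hδ hr), ?_⟩
  exact div_le_one_of_le₀ (T_mono D.isBounded hδ hsub hΛδ hx hy)
    (T_pos_of_reachable D.isBounded hδ hr).le

/-- Hence ANY limit of the ratio is `≤ 1`: the crux's `d^{1/2} ≤ 1` is consistent (TIGHT on the
diagonal, where it is `1`). [folklore] -/
theorem limit_le_one {D D' : DobrushinDomain} {a b : ℝ → Site 2}
    (hD : SAW.IsEndpointApprox D a b) (hD' : SAW.IsEndpointApprox D' a b)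
    (hsub : D'.carrier ⊆ D.carrier) {L : ℝ}
    (hL : Tendsto (ratio D D' a b) (𝓝[>] 0) (𝓝 L)) : L ≤ 1 :=
  le_of_tendsto hL ((eventually_ratio_mem_Ioc hD hD' hsub).mono fun _ h => h.2)

/-- NATURAL VARIANT REFUTED (relative to an off-diagonal datum): with a NEGATIVE exponent `e < 0`
in place of `1/2`, the conclusion `ratio → d^e` is false at every genuine sub-hull (`0 < d < 1`),
since `d^e > 1 ≥ lim`. (Positive exponents `e ≠ 1/2` cannot be separated from `1/2` by
monotonicity: that needs the McCoy–Wu asymptotics, not formalised.) [folklore] -/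
theorem not_tendsto_rpow_of_neg {D D' : DobrushinDomain} {a b : ℝ → Site 2}
    (hD : SAW.IsEndpointApprox D a b) (hD' : SAW.IsEndpointApprox D' a b)
    (hsub : D'.carrier ⊆ D.carrier) {d e : ℝ} (hd : 0 < d) (hd1 : d < 1) (he : e < 0) :
    ¬ Tendsto (ratio D D' a b) (𝓝[>] 0) (𝓝 (d ^ e)) := fun hL =>
  absurd (limit_le_one hD hD' hsub hL) (not_le.2 (Real.one_lt_rpow_of_pos_of_lt_one_of_neg hd hd1 he))

end Summit.CriticalPhenomena.SAWScalingLimit.Theorems.IsingBoundaryRatio.Negative
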